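/-
Copyright (c) 2026. All rights reserved.
Released under Apache 2.0 license as described in the file LICENSE.

[NoBLE17] = Fitzner–van der Hofstad, "Generalized approach to the non-backtracking lace expansion",
Probab. Theory Relat. Fields 169 (2017) 1041–1119.  Page numbers below are PTRF pages.
-/
import Literature.Probability.FitznerVanDerHofstad2017.NobleSimplifiedFormF3
import Literature.Probability.FitznerVanDerHofstad2017.NobleInstantiate
import HarnessLib

/-!
# Outward rounding is sound for the EXTENDED simplified form (the thirteen Assumption-2.7 constants)

[NoBLE17] Assumption 2.7 lists one-sided bounds on the coefficients of the simplified NoBLE form: upper bounds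
`β_μ̄, β̄_Π, β_Ψ, c̄_Φ, β_{α,Φ}, β_{R,Φ}, ᾱ_F, β_{R,F}, β_{ΔR,Φ}, β_{|ΔR,F|}` and `β̲_{ΔR,F}` (the constant in the one-sided
lower bound `R̂_F(0) − R̂_F(k) ≥ −β̲_{ΔR,F}[1 − D̂(k)]`), and the two LOWER bounds `c̲_Φ ≤ c_Φ`, `α̲_F ≤ α_F`.  Every bound
remains true when an upper-bound constant is increased and a lower-bound constant is decreased; this is what lets a
kernel certificate stated for ONE rational table serve for the true (interval-valued) constants.

For the eight constants of `NobleBeta` the tree records this as `BetaLE` / `nobleSimplifiedFormAt_mono`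
(`NobleInstantiate`).  This module is the twin for the five further constants `NobleBetaF3 = (c̲_Φ, ᾱ_F, β_{R,F},
β_{ΔR,Φ}, β_{|ΔR,F|})` that the `f₃` analysis consumes (`NobleSimplifiedFormF3At`, module `NobleSimplifiedFormF3`):

* `BetaF3LE E E'` — the table `E'` is WEAKER than `E` (`c̲_Φ` rounded down, the four upper bounds rounded up), with
  `refl`, `trans` and the componentwise criterion `BetaF3LE.ofFn` for vectors `Fin 5 → ℝ` in the order of
  `BetaMap.extraOfInputs`;
* `nobleSimplifiedFormF3At_mono` — `BetaLE B B' → BetaF3LE E E' → NobleSimplifiedFormF3At d p B E →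
  NobleSimplifiedFormF3At d p B' E'`;
* `NobleBetaF3.further_of_weaker` — the side condition `β_{α,Φ} + β_{R,Φ} < c̲_Φ` of Assumption 2.7 checked on the
  weaker tables implies it for the stronger ones;
* `NobleBetaF3.toArgs_dom` — the dictionary `NobleBetaF3.toArgs d B E Γ₂` into the ten `β`-arguments of the typed
  `f₃` bound map (`F3Bounds.Args`) is monotone: weaker tables and a larger `Γ₂` give arguments that DOMINATE in the
  sense of `F3Bounds.Args.Dom` (so `F3Bounds.boundH1_mono`, …, `boundHMono_mono` apply), the `K̲ = 1/(α̲_F − β̲_{ΔR,F})`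
  slot using positivity of the weaker gap.

d-generic; no numeral; nothing cited as a fact; additive (no existing module is modified).
-/

namespace Literature.Probability.FitznerVanDerHofstad2017

open Literature.Barriers.CriticalPhenomena Literature.Probability.Percolation
open Literature.Probability.LatticeModels
open Literature.Probability.RandomPlanarGeometry.SAW.Zd (normSq)

variable {d : ℕ}

/-- `BetaF3LE E E'`: the table `E'` of the five further Assumption-2.7 constants is WEAKER than `E` — the lower-bound
constant `c̲_Φ` of `E'` is at most that of `E`, and each upper-bound constant (`ᾱ_F, β_{R,F}, β_{ΔR,Φ}, β_{|ΔR,F|}`) of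
`E'` is at least that of `E`.  This is the direction of outward rounding.
[cite: FitznerVanDerHofstad2016NoBLE, Assumption 2.7 (a), (c) (each constant is a one-sided bound), PTRF pp. 1059–1060] -/
structure BetaF3LE (E E' : NobleBetaF3) : Prop where
  cΦlow : E'.cΦlow ≤ E.cΦlow
  αFup : E.αFup ≤ E'.αFup
  βRF : E.βRF ≤ E'.βRF
  βΔRΦ : E.βΔRΦ ≤ E'.βΔRΦ
  βΔRFabs : E.βΔRFabs ≤ E'.βΔRFabs

/-- `BetaF3LE` is reflexive. [folklore] -/
theorem BetaF3LE.refl (E : NobleBetaF3) : BetaF3LE E E :=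
  ⟨le_rfl, le_rfl, le_rfl, le_rfl, le_rfl⟩

/-- `BetaF3LE` is transitive. [folklore] -/
theorem BetaF3LE.trans {E E' E'' : NobleBetaF3} (h₁ : BetaF3LE E E') (h₂ : BetaF3LE E' E'') :
    BetaF3LE E E'' :=
  ⟨h₂.cΦlow.trans h₁.cΦlow, h₁.αFup.trans h₂.αFup, h₁.βRF.trans h₂.βRF, h₁.βΔRΦ.trans h₂.βΔRΦ,
    h₁.βΔRFabs.trans h₂.βΔRFabs⟩

/-- `BetaLE` is transitive (companion to `BetaLE.refl` of `NobleInstantiate`). [folklore] -/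
theorem BetaLE.trans' {B B' B'' : NobleBeta} (h₁ : BetaLE B B') (h₂ : BetaLE B' B'') : BetaLE B B'' :=
  ⟨h₁.βμ.trans h₂.βμ, h₁.βPi.trans h₂.βPi, h₁.βΨ.trans h₂.βΨ, h₁.cΦup.trans h₂.cΦup, h₁.βαΦ.trans h₂.βαΦ,
    h₁.βRΦ.trans h₂.βRΦ, h₂.αFlow.trans h₁.αFlow, h₁.βΔ.trans h₂.βΔ⟩

/-- Componentwise criterion for vectors in the order of `BetaMap.extraOfInputs` (`c̲_Φ, ᾱ_F, β_{R,F}, β_{ΔR,Φ},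
β_{|ΔR,F|}`): component `0` rounded down, components `1`–`4` rounded up. [folklore] -/
theorem BetaF3LE.ofFn {e e' : Fin 5 → ℝ} (h0 : e' 0 ≤ e 0) (h1 : e 1 ≤ e' 1) (h2 : e 2 ≤ e' 2)
    (h3 : e 3 ≤ e' 3) (h4 : e 4 ≤ e' 4) : BetaF3LE (NobleBetaF3.ofFn e) (NobleBetaF3.ofFn e') :=
  ⟨h0, h1, h2, h3, h4⟩

/-- **Monotonicity of the extended simplified NoBLE form in the constants**: if the form holds with the tables
`(B, E)` and `(B', E')` are weaker (`BetaLE B B'`, `BetaF3LE E E'`), it holds with `(B', E')` — same witnesses, every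
one-sided bound relaxed. [cite: FitznerVanDerHofstad2016NoBLE, Assumption 2.7 (a)–(c), PTRF pp. 1059–1060] -/
theorem nobleSimplifiedFormF3At_mono {p : unitInterval} {B B' : NobleBeta} {E E' : NobleBetaF3}
    (hB : BetaLE B B') (hE : BetaF3LE E E') (h : NobleSimplifiedFormF3At d p B E) :
    NobleSimplifiedFormF3At d p B' E' := by
  obtain ⟨cΦ, αΦ, cF, αF, ψ, π, lam, RΦ, RF, hRΦ, hRF, hform, hμ, hF0, hlam0, hlam1, hratio, hcΦ0,
    hcΦ, hαΦ, hαF, hπ, hψ, hRΦle, hRFb, hcΦlow, hαFup, hRFle, hsΦ, hΔΦ, hsF, hΔF⟩ := h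
  refine ⟨cΦ, αΦ, cF, αF, ψ, π, lam, RΦ, RF, hRΦ, hRF, hform, hμ, hF0, hlam0, hlam1, ?_, hcΦ0,
    hcΦ.trans hB.cΦup, hαΦ.trans hB.βαΦ, hB.αFlow.trans hαF, hπ.trans hB.βPi, ?_,
    hRΦle.trans hB.βRΦ, fun k hk => ?_, hE.cΦlow.trans hcΦlow, hαFup.trans hE.αFup, hRFle.trans hE.βRF,
    hsΦ, hΔΦ.trans hE.βΔRΦ, hsF, hΔF.trans hE.βΔRFabs⟩
  · exact hratio.trans (mul_le_mul_of_nonneg_right hB.βμ (nobleMu_nonneg d p))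
  · linarith [hB.βΨ]
  · have h1 := hRFb k hk
    have h2 : B.βΔ * (1 - Dhat d k) ≤ B'.βΔ * (1 - Dhat d k) :=
      mul_le_mul_of_nonneg_right hB.βΔ (one_sub_Dhat_nonneg k)
    linarith

/-- The side condition "Further, … `c̲_Φ − β_{α,Φ} − β_{R,Φ} > 0`" of Assumption 2.7 is ANTI-monotone: checked on
weaker tables it holds for the stronger ones. [cite: FitznerVanDerHofstad2016NoBLE, Assumption 2.7 (the line following (c)), PTRF p. 1060] -/
theorem NobleBetaF3.further_of_weaker {B B' : NobleBeta} {E E' : NobleBetaF3} (hB : BetaLE B B')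
    (hE : BetaF3LE E E') (h : NobleBetaF3.Further B' E') : NobleBetaF3.Further B E := by
  unfold NobleBetaF3.Further at h ⊢
  linarith [hB.βαΦ, hB.βRΦ, hE.cΦlow]

/-- The first side condition `α̲_F − β̲_{ΔR,F} > 0` is anti-monotone likewise. [cite: FitznerVanDerHofstad2016NoBLE, Assumption 2.7, PTRF p. 1060] -/
theorem BetaLE.gap_of_weaker {B B' : NobleBeta} (hB : BetaLE B B') (h : B'.βΔ < B'.αFlow) :
    B.βΔ < B.αFlow := by
  linarith [hB.αFlow, hB.βΔ]

/-- **The dictionary into the `f₃` bound map is monotone.**  Weaker tables `(B', E')`, a larger bootstrap constant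
`Γ₂ ≤ Γ₂'` and a positive weaker gap `β̲'_{ΔR,F} < α̲'_F` give `β`-arguments that dominate:
`F3Bounds.Args.Dom (toArgs d B E Γ₂) (toArgs d B' E' Γ₂')` — `Γ₂′ = ((2d−2)/(2d−1))Γ₂` is monotone for `d ≥ 1`, the
eight copied slots by `BetaLE`/`BetaF3LE`, and `K̲ = 1/(α̲_F − β̲_{ΔR,F})` grows as the gap shrinks.  Hence every
`F3Bounds.boundH*` functional evaluated at the stronger tables is at most its value at the weaker ones
(`F3Bounds.boundH1_mono`, …, `boundHMono_mono`).
[cite: FitznerVanDerHofstad2016NoBLE, §3.3.4 "Bounds on key quantities" (K̲, Γ₂′) and §3.3.5 (3.71)–(3.87), PTRF pp. 1071–1079] -/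
theorem NobleBetaF3.toArgs_dom (hd : 1 ≤ d) {B B' : NobleBeta} {E E' : NobleBetaF3} {Γ₂ Γ₂' : ℝ}
    (hB : BetaLE B B') (hE : BetaF3LE E E') (hΓ : Γ₂ ≤ Γ₂') (hgap' : B'.βΔ < B'.αFlow) :
    F3Bounds.Args.Dom (NobleBetaF3.toArgs d B E Γ₂) (NobleBetaF3.toArgs d B' E' Γ₂') := by
  have hd' : (1 : ℝ) ≤ d := by exact_mod_cast hd
  refine ⟨?_, hB.cΦup, hB.αFlow, hE.αFup, hB.βαΦ, hE.βRF, hB.βRΦ, hE.βΔRFabs, hE.βΔRΦ, ?_⟩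
  · show (2 * (d : ℝ) - 2) / (2 * d - 1) * Γ₂ ≤ (2 * (d : ℝ) - 2) / (2 * d - 1) * Γ₂'
    exact mul_le_mul_of_nonneg_left hΓ (div_nonneg (by linarith) (by linarith))
  · show 1 / (B.αFlow - B.βΔ) ≤ 1 / (B'.αFlow - B'.βΔ)
    exact one_div_le_one_div_of_le (sub_pos.2 hgap') (by linarith [hB.αFlow, hB.βΔ])

/-- The same with equal bootstrap constants. [folklore] -/
theorem NobleBetaF3.toArgs_dom' (hd : 1 ≤ d) {B B' : NobleBeta} {E E' : NobleBetaF3} (Γ₂ : ℝ)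
    (hB : BetaLE B B') (hE : BetaF3LE E E') (hgap' : B'.βΔ < B'.αFlow) :
    F3Bounds.Args.Dom (NobleBetaF3.toArgs d B E Γ₂) (NobleBetaF3.toArgs d B' E' Γ₂) :=
  NobleBetaF3.toArgs_dom hd hB hE le_rfl hgap'

end Literature.Probability.FitznerVanDerHofstad2017
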